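import Summits.HodgeConjecture.HodgeConjecture.Theorems.K2E3WittBoundedCartanPackage   -- ★ p856917 (K2E3-p09): the letter `hrawΩ` (`exists_rawCartanSet`), `frameDiag_norm`, `exists_kernelDatum`
import Summits.HodgeConjecture.HodgeConjecture.Theorems.K2E3WittKernelSort              -- ★ p856919 (this seat): `exists_perm_kernel_antitone`
import HarnessLib

/-!
# The bounded Cartan decomposition of `U(σ, wittFormOn e Han)(K)` in SORTED DIAGONAL NORMAL FORM — the `hrawW`-shaped letter in the compact-SET currency
# (crux H413, U12-g ∕ 13a road A, file P0b; any anisotropic kernel, any isometric involution, any ramification)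

Cell `hodgecm-mathlib`, Track B «K2-LIT», crux item `stmt-HodgeConjecture-24833` (h413), socket U12-g `sig_K2E3LocalIrrepAdmissible`, 13a road A (set currency,
RULINGS #14∕#15); seat K2E3-p10 (g4), line lead.  THEOREMS ONLY; count-neutral helper (`--supports stmt-HodgeConjecture-24833 --as helper`).

★ `K2E3WittBoundedCartanPackage.exists_rawCartanSet` (K2E3-p09 (g3)) gives, for every `g ∈ U = U(σ, W)`, `W = wittFormOn e Han`, elements `k₁, k₂ ∈ U` with
`k₁^{±1}, k₂^{±1}` bounded by `exp b` (ONE `b` for all `g`) and `X = k₁ g k₂` FRAME-DIAGONAL: `X_{pq} = 0` for `p ≠ q` as soon as `p` or `q` is a frame slot.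
This file turns that into EXACTLY the shape of the `K₀`-currency letter `hrawW` of ★ p856772 `K2E3WittLeviCartanRecursionKernel` with `≤ 1` replaced by `≤ exp b`:

* §1 `exists_boundedCartan_diagonal` — the KERNEL BLOCK IS ABSORBED: `X = D · (D⁻¹ X)` with `D = diag(X_{pp} on the frame, 1 on the kernel) ∈ U` and `D⁻¹ X =
  1 ⊕ h` (`h` the `Han`-unitary kernel block, bounded by coercivity ★ `exists_kernelDatum`), so `k₁ g (k₂ X⁻¹ D) = D` is DIAGONAL with `d ≡ 1` on the kernel
  slots, `σ(d_p) d_{rev p} = 1` (★ `frameDiag_norm`), and `k₂ X⁻¹ D` is again bounded (★ F1 `v_inv_apply_le`, `v_mul_apply_le`).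
* §2 **`exists_boundedCartan_sorted`** — the exponents are then SORTED by a kernel-fixing Weyl permutation (★ `exists_perm_kernel_antitone`, ★ F1
  `permGL_mem_unitaryGroupOfForm_witt`): `∃ b, ∀ g, ∃ k₁ k₂` (`k^{±1} ≤ exp b`), `∃ d E, k₁ g k₂ = diag(d)`, `σ(d_i) d_{rev i} = 1`, `d ≡ 1` on the kernel,
  `v(d_k) = exp(−E_k)`, `E` antitone — the base case of the set-twin of the Levi recursion ★ p856772 (P2a) and the input of the `hG` packaging (P1).

HONEST LABEL: structure theorem; HC_CM is proved only modulo the 7 printed citations (2 remaining named inputs: hLiu418 = stmt-HodgeConjecture-24832, h413 =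
stmt-HodgeConjecture-24833) until rung 0 closes; 13a is ★ at odd `N` only.

References: [BruhatTits1972] F. Bruhat, J. Tits, *Groupes réductifs sur un corps local I*, Publ. Math. IHÉS 41 (1972), (4.4.3); [Tits1979] J. Tits, *Reductive groups
over local fields*, PSPM 33.1 (1979), §3.3.3; [PlatonovRapinchuk1994] V. Platonov, A. Rapinchuk, *Algebraic Groups and Number Theory* (1994), §3.1 Thm. 3.1;
[Macdonald1995] I. G. Macdonald, *Symmetric Functions and Hall Polynomials* (1995), Ch. V §2.
-/

set_option autoImplicit false
-- the mandated namespace repeats `HodgeConjecture.HodgeConjecture`, as in every `Theorems/*.lean` of this sub-problem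
set_option linter.dupNamespace false

noncomputable section

open scoped Valued WithZero Matrix MatrixGroups
open Matrix

namespace Summit.HodgeConjecture.HodgeConjecture.Cruxes.H413.K2E3WittBoundedCartanNormalForm

open Literature.NumberTheory.Automorphic Literature.NumberTheory.Automorphic.UnitaryGroup Literature.NumberTheory.Automorphic.HermitianLattice
open Literature.NumberTheory.Automorphic.CartanUnique
open K2E3LocalUnitaryWitt K2E3WittCartanUnramified K2E3WittLeviConeCentreKernel K2E3WittFrameTools K2E3WittBoundedPivot K2E3WittBoundedStep
  K2E3WittBoundedCartanPackage K2E3WittKernelSort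

variable {K : Type*} [Field K] [Valued K ℤᵐ⁰] {ϖ : K} {σ : K →+* K} {N r m : ℕ} (e : WittIndex r m ≃ Fin N)
  (hstd : ∀ x, (e x).val = Sum.elim (fun i : Fin r => i.val) (Sum.elim (fun u : Fin m => r + u.val) (fun j : Fin r => r + m + j.val)) x)
  (Han : Matrix (Fin m) (Fin m) K)

/-! ## §1 Absorbing the kernel block: the bounded Cartan decomposition in DIAGONAL form -/

section Diagonal

/-- `exp a ≤ exp c` in `ℤᵐ⁰` for naturals `a ≤ c`. [folklore] -/
theorem exp_natCast_le_exp_natCast {a c : ℕ} (h : a ≤ c) : WithZero.exp (a : ℤ) ≤ WithZero.exp (c : ℤ) :=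
  WithZero.exp_le_exp.2 (by exact_mod_cast h)

/-- `exp a * exp c = exp (a + c)` in `ℤᵐ⁰` for naturals. [folklore] -/
theorem exp_natCast_mul_exp_natCast (a c : ℕ) : WithZero.exp (a : ℤ) * WithZero.exp (c : ℤ) = WithZero.exp ((a + c : ℕ) : ℤ) := by
  rw [← WithZero.exp_add]; push_cast; rfl

include hstd in
/-- **THE BOUNDED CARTAN DECOMPOSITION IN DIAGONAL FORM.**  `𝒪[K]` compact, `ϖ` a uniformiser, `σ` an isometric involution, `e` standard, `Han` σ-hermitian ANISOTROPIC
(any `m`): there is ONE `b : ℕ` such that every `g ∈ U(σ, wittFormOn e Han)` is `k₁⁻¹ · diag(d) · k₂⁻¹` with `k₁, k₂ ∈ U`, all entries of `k₁^{±1}, k₂^{±1}` bounded by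
`exp b`, `σ(d_i) · d_{rev i} = 1` for all `i` and `d ≡ 1` ON THE KERNEL SLOTS — the kernel block of ★ `exists_rawCartanSet`'s frame-diagonal `X` is absorbed into
`k₂` as `X⁻¹ D`, bounded by coercivity. [cite: BruhatTits1972, (4.4.3)] [cite: Tits1979, §3.3.3] [cite: PlatonovRapinchuk1994, §3.1 Thm. 3.1] -/
theorem exists_boundedCartan_diagonal [CompactSpace 𝒪[K]] (hϖ : Valued.v ϖ = WithZero.exp (-1 : ℤ)) (hσ : ∀ x, σ (σ x) = x)
    (hvσ : ∀ x, Valued.v (σ x) = Valued.v x) (hHanh : (Han.map σ)ᵀ = Han) (han : ∀ z : Fin m → K, hermForm σ Han z z = 0 → z = 0) :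
    ∃ b : ℕ, ∀ g : unitaryGroupOfForm σ (wittFormOn e Han), ∃ k₁ k₂ : unitaryGroupOfForm σ (wittFormOn e Han),
      (∀ i j, Valued.v (((k₁ : GL (Fin N) K) : Matrix (Fin N) (Fin N) K) i j) ≤ WithZero.exp (b : ℤ)) ∧
      (∀ i j, Valued.v ((((k₁⁻¹ : unitaryGroupOfForm σ (wittFormOn e Han)) : GL (Fin N) K) : Matrix (Fin N) (Fin N) K) i j) ≤ WithZero.exp (b : ℤ)) ∧
      (∀ i j, Valued.v (((k₂ : GL (Fin N) K) : Matrix (Fin N) (Fin N) K) i j) ≤ WithZero.exp (b : ℤ)) ∧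
      (∀ i j, Valued.v ((((k₂⁻¹ : unitaryGroupOfForm σ (wittFormOn e Han)) : GL (Fin N) K) : Matrix (Fin N) (Fin N) K) i j) ≤ WithZero.exp (b : ℤ)) ∧
      ∃ d : Fin N → K, (((k₁ * g * k₂ : unitaryGroupOfForm σ (wittFormOn e Han)) : GL (Fin N) K) : Matrix (Fin N) (Fin N) K) = Matrix.diagonal d ∧
        (∀ i, σ (d i) * d (Fin.rev i) = 1) ∧ (∀ u : Fin m, d (e (Sum.inr (Sum.inl u))) = 1) := by
  classical
  have hHan : IsUnit Han.det := by
    rw [isUnit_iff_ne_zero]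
    intro h0
    obtain ⟨z, hz0, hz⟩ := Matrix.exists_mulVec_eq_zero_iff.2 h0
    exact hz0 (han z (by rw [hermForm_apply, hz, dotProduct_zero]))
  obtain ⟨b₀, hB1, hHanB, hHaniB, hcoer⟩ := exists_kernelDatum σ Han hϖ hvσ han
  obtain ⟨b, hb⟩ := exists_rawCartanSet e hstd Han hϖ hσ hvσ hHanh han
  have hW : ∀ p q, Valued.v (wittFormOn e Han p q) ≤ WithZero.exp (b₀ : ℤ) := v_wittFormOn_le e hstd Han hB1 hHanB
  have hWi : ∀ p q, Valued.v (wittFormOn e Han⁻¹ p q) ≤ WithZero.exp (b₀ : ℤ) := v_wittFormOn_le e hstd Han⁻¹ hB1 hHaniB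
  refine ⟨b + 3 * b₀, fun g => ?_⟩
  obtain ⟨k₁, k₂, hk₁, hk₁i, hk₂, hk₂i, hX⟩ := hb g
  set X : unitaryGroupOfForm σ (wittFormOn e Han) := k₁ * g * k₂ with hX_def
  set A : Matrix (Fin N) (Fin N) K := ((X : GL (Fin N) K) : Matrix (Fin N) (Fin N) K) with hA
  have hA0 : ∀ p q : Fin N, p ≠ q → ((∀ u : Fin m, p ≠ e (Sum.inr (Sum.inl u))) ∨ (∀ u : Fin m, q ≠ e (Sum.inr (Sum.inl u)))) → A p q = 0 := hX
  -- frame slots versus kernel slots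
  have hker : ∀ (u : Fin m), ¬ ∀ u' : Fin m, e (Sum.inr (Sum.inl u)) ≠ e (Sum.inr (Sum.inl u')) := fun u h => h u rfl
  have hfk : ∀ {p : Fin N}, (∀ u : Fin m, p ≠ e (Sum.inr (Sum.inl u))) → ∀ u : Fin m, p ≠ e (Sum.inr (Sum.inl u)) := fun h => h
  -- the frame diagonal: `σ(A_pp) A_{rev p, rev p} = 1`, so `A_pp ≠ 0`
  have hnorm : ∀ {p : Fin N}, (∀ u : Fin m, p ≠ e (Sum.inr (Sum.inl u))) → σ (A p p) * A (Fin.rev p) (Fin.rev p) = 1 :=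
    fun hp => frameDiag_norm σ e hstd Han X hX hp
  have hApp0 : ∀ {p : Fin N}, (∀ u : Fin m, p ≠ e (Sum.inr (Sum.inl u))) → A p p ≠ 0 := by
    intro p hp h0
    have h := hnorm hp
    rw [h0, map_zero, zero_mul] at h
    exact zero_ne_one h
  -- the diagonal `D`: `A_pp` on the frame, `1` on the kernel
  set d₀ : Fin N → K := fun p => if (∀ u : Fin m, p ≠ e (Sum.inr (Sum.inl u))) then A p p else 1 with hd₀_def
  have hd₀_frame : ∀ {p : Fin N}, (∀ u : Fin m, p ≠ e (Sum.inr (Sum.inl u))) → d₀ p = A p p := fun hp => by rw [hd₀_def]; exact if_pos hp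
  have hd₀_ker : ∀ u : Fin m, d₀ (e (Sum.inr (Sum.inl u))) = 1 := fun u => by rw [hd₀_def]; exact if_neg (hker u)
  have hd₀0 : ∀ p, d₀ p ≠ 0 := by
    intro p
    by_cases hp : ∀ u : Fin m, p ≠ e (Sum.inr (Sum.inl u))
    · rw [hd₀_frame hp]; exact hApp0 hp
    · rw [hd₀_def]; dsimp only; rw [if_neg hp]; exact one_ne_zero
  have hd₀n : ∀ p, σ (d₀ p) * d₀ (Fin.rev p) = 1 := by
    intro p
    by_cases hp : ∀ u : Fin m, p ≠ e (Sum.inr (Sum.inl u))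
    · rw [hd₀_frame hp, hd₀_frame (frame_rev e hstd hp)]; exact hnorm hp
    · push Not at hp
      obtain ⟨u, rfl⟩ := hp
      rw [hd₀_ker, rev_apply_inr_inl' e hstd, hd₀_ker, map_one, mul_one]
  set dU : Fin N → Kˣ := fun p => Units.mk0 (d₀ p) (hd₀0 p) with hdU_def
  have hdUval : ∀ p, (dU p : K) = d₀ p := fun p => rfl
  -- `D ∈ U(σ, W)`
  have hDmem : diagonalGL (Fin N) K dU ∈ unitaryGroupOfForm σ (wittFormOn e Han) := by
    refine glDiagonal_mem_unitaryGroupOfForm σ (wittFormOn e Han) dU fun a c hac => ?_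
    rw [hdUval, hdUval]
    by_cases ha : ∀ u : Fin m, a ≠ e (Sum.inr (Sum.inl u))
    · rw [wittFormOn_apply_of_frame e hstd Han ha] at hac
      have hc : c = Fin.rev a := by by_contra h; exact hac (if_neg h)
      rw [hc]; exact hd₀n a
    · push Not at ha
      obtain ⟨u, rfl⟩ := ha
      by_cases hc : ∀ u' : Fin m, c ≠ e (Sum.inr (Sum.inl u'))
      · exact absurd (wittFormOn_kernel_frame e Han u hc) hac
      · push Not at hc
        obtain ⟨u', rfl⟩ := hc
        rw [hd₀_ker, hd₀_ker, map_one, mul_one]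
  set D : unitaryGroupOfForm σ (wittFormOn e Han) := ⟨diagonalGL (Fin N) K dU, hDmem⟩ with hD_def
  have hDmat : ((D : GL (Fin N) K) : Matrix (Fin N) (Fin N) K) = Matrix.diagonal d₀ := by
    change ((diagonalGL (Fin N) K dU : GL (Fin N) K) : Matrix (Fin N) (Fin N) K) = _
    rw [coe_diagonalGL]
    rfl
  have hDimat : (((D⁻¹ : unitaryGroupOfForm σ (wittFormOn e Han)) : GL (Fin N) K) : Matrix (Fin N) (Fin N) K) = Matrix.diagonal fun p => (d₀ p)⁻¹ := by
    rw [Subgroup.coe_inv]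
    change (((diagonalGL (Fin N) K dU)⁻¹ : GL (Fin N) K) : Matrix (Fin N) (Fin N) K) = _
    rw [← map_inv, coe_diagonalGL]
    refine congrArg Matrix.diagonal (funext fun p => ?_)
    rw [Pi.inv_apply, Units.val_inv_eq_inv_val, hdUval]
  -- `Z = D⁻¹ X = 1 ⊕ h` is bounded by `exp b₀`
  set Z : unitaryGroupOfForm σ (wittFormOn e Han) := D⁻¹ * X with hZ_def
  have hZmat : ∀ p q, ((Z : GL (Fin N) K) : Matrix (Fin N) (Fin N) K) p q = (d₀ p)⁻¹ * A p q := fun p q => by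
    rw [hZ_def, Subgroup.coe_mul, Units.val_mul, hDimat, Matrix.diagonal_mul]
  -- the kernel block is bounded by coercivity: `v(A_{u' u})² ≤ exp b₀ · v(Han_{uu}) ≤ (exp b₀)²`
  have hkerb : ∀ u u' : Fin m, Valued.v (A (e (Sum.inr (Sum.inl u'))) (e (Sum.inr (Sum.inl u)))) ≤ WithZero.exp (b₀ : ℤ) := by
    intro u u'
    have hU : (A.map σ)ᵀ * wittFormOn e Han * A = wittFormOn e Han := mem_unitaryGroupOfForm_iff.1 X.2
    have hzero : ∀ p : Fin N, (∀ u₁ : Fin m, p ≠ e (Sum.inr (Sum.inl u₁))) → Valued.v ((fun i => A i (e (Sum.inr (Sum.inl u)))) p) ≤ 0 := by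
      intro p hp
      dsimp only
      rw [hA0 p _ (hp u) (Or.inl hp), map_zero]
    have h := v_kernel_sq_le σ e hstd Han hvσ hcoer (fun i => A i (e (Sum.inr (Sum.inl u)))) (F := 0) hzero u'
    rw [hermForm_col_col σ e hstd Han X, wittFormOn_kernel_kernel, mul_zero, max_eq_left zero_le] at h
    exact le_of_mul_self_le (h.trans (mul_le_mul' le_rfl (hHanB u u)))
  have hZb : ∀ p q, Valued.v (((Z : GL (Fin N) K) : Matrix (Fin N) (Fin N) K) p q) ≤ WithZero.exp (b₀ : ℤ) := by
    intro p q
    rw [hZmat]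
    by_cases hp : ∀ u : Fin m, p ≠ e (Sum.inr (Sum.inl u))
    · by_cases hpq : p = q
      · subst hpq
        rw [hd₀_frame hp, inv_mul_cancel₀ (hApp0 hp), map_one]; exact hB1
      · rw [hA0 p q hpq (Or.inl hp), mul_zero, map_zero]; exact zero_le
    · push Not at hp
      obtain ⟨u, rfl⟩ := hp
      rw [hd₀_ker, inv_one, one_mul]
      by_cases hq : ∀ u' : Fin m, q ≠ e (Sum.inr (Sum.inl u'))
      · rw [hA0 _ q (hq u).symm (Or.inr hq), map_zero]; exact zero_le
      · push Not at hq
        obtain ⟨u', rfl⟩ := hq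
        exact hkerb u' u
  have hZib : ∀ p q, Valued.v ((((Z⁻¹ : unitaryGroupOfForm σ (wittFormOn e Han)) : GL (Fin N) K) : Matrix (Fin N) (Fin N) K) p q) ≤
      WithZero.exp ((3 * b₀ : ℕ) : ℤ) := by
    intro p q
    refine (v_inv_apply_le σ e Han hvσ hHan Z hW hWi hZb p q).trans (le_of_eq ?_)
    rw [exp_natCast_mul_exp_natCast, exp_natCast_mul_exp_natCast]; congr 2; ring
  -- the new `k₂' = k₂ Z⁻¹`
  have hprod : k₁ * g * (k₂ * Z⁻¹) = D := by
    rw [← mul_assoc, ← hX_def, hZ_def, _root_.mul_inv_rev, inv_inv, mul_inv_cancel_left]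
  refine ⟨k₁, k₂ * Z⁻¹, fun i j => (hk₁ i j).trans (exp_natCast_le_exp_natCast (by omega)),
    fun i j => (hk₁i i j).trans (exp_natCast_le_exp_natCast (by omega)), fun i j => ?_, fun i j => ?_, d₀, ?_, hd₀n, hd₀_ker⟩
  · rw [Subgroup.coe_mul, Units.val_mul]
    refine (v_mul_apply_le hk₂ hZib i j).trans (le_of_eq ?_)
    rw [exp_natCast_mul_exp_natCast]
  · rw [_root_.mul_inv_rev, inv_inv, Subgroup.coe_mul, Units.val_mul]
    refine (v_mul_apply_le hZb hk₂i i j).trans ?_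
    rw [exp_natCast_mul_exp_natCast]
    exact exp_natCast_le_exp_natCast (by omega)
  · rw [hprod, hDmat]

end Diagonal

/-! ## §2 Sorting the exponents: the `hrawW`-shaped bounded letter -/

section Sorted

include hstd in
/-- **THE BOUNDED CARTAN DECOMPOSITION IN SORTED DIAGONAL NORMAL FORM — the `hrawW`-shaped letter of the compact-SET currency.**  `𝒪[K]` compact, `ϖ` a uniformiser,
`σ` an isometric involution, `e` standard, `Han` σ-hermitian anisotropic (ANY `m`, ANY ramification): ONE `b : ℕ` such that every `g ∈ U(σ, wittFormOn e Han)` satisfies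
`k₁ g k₂ = diag(d)` with `k₁, k₂ ∈ U`, `k₁^{±1}, k₂^{±1}` bounded by `exp b`, `σ(d_i) d_{rev i} = 1`, `d ≡ 1` on the kernel slots, `v(d_k) = exp(−E_k)` with `E` ANTITONE
along `Fin N` — EXACTLY the `hrawW` binder of ★ p856772 `exists_leviIntegral_mul_diagonalGL_mul_kernel` with `≤ 1` replaced by `≤ exp b` (§1 + the kernel-fixing
sort ★ `exists_perm_kernel_antitone`, whose matrix is in `U` by ★ `permGL_mem_unitaryGroupOfForm_witt`). [cite: BruhatTits1972, (4.4.3)] [cite: Tits1979, §3.3.3]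
[cite: Macdonald1995, Ch. V §2] [cite: PlatonovRapinchuk1994, §3.1 Thm. 3.1] -/
theorem exists_boundedCartan_sorted [CompactSpace 𝒪[K]] (hϖ : Valued.v ϖ = WithZero.exp (-1 : ℤ)) (hσ : ∀ x, σ (σ x) = x)
    (hvσ : ∀ x, Valued.v (σ x) = Valued.v x) (hHanh : (Han.map σ)ᵀ = Han) (han : ∀ z : Fin m → K, hermForm σ Han z z = 0 → z = 0) :
    ∃ b : ℕ, ∀ g : unitaryGroupOfForm σ (wittFormOn e Han), ∃ k₁ k₂ : unitaryGroupOfForm σ (wittFormOn e Han),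
      (∀ i j, Valued.v (((k₁ : GL (Fin N) K) : Matrix (Fin N) (Fin N) K) i j) ≤ WithZero.exp (b : ℤ)) ∧
      (∀ i j, Valued.v ((((k₁⁻¹ : unitaryGroupOfForm σ (wittFormOn e Han)) : GL (Fin N) K) : Matrix (Fin N) (Fin N) K) i j) ≤ WithZero.exp (b : ℤ)) ∧
      (∀ i j, Valued.v (((k₂ : GL (Fin N) K) : Matrix (Fin N) (Fin N) K) i j) ≤ WithZero.exp (b : ℤ)) ∧
      (∀ i j, Valued.v ((((k₂⁻¹ : unitaryGroupOfForm σ (wittFormOn e Han)) : GL (Fin N) K) : Matrix (Fin N) (Fin N) K) i j) ≤ WithZero.exp (b : ℤ)) ∧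
      ∃ (d : Fin N → K) (E : Fin N → ℤ), (((k₁ * g * k₂ : unitaryGroupOfForm σ (wittFormOn e Han)) : GL (Fin N) K) : Matrix (Fin N) (Fin N) K) = Matrix.diagonal d ∧
        (∀ i, σ (d i) * d (Fin.rev i) = 1) ∧ (∀ u : Fin m, d (e (Sum.inr (Sum.inl u))) = 1) ∧
        (∀ k, Valued.v (d k) = WithZero.exp (-E k)) ∧ (∀ i j : Fin N, i ≤ j → E j ≤ E i) := by
  classical
  obtain ⟨b, hb⟩ := exists_boundedCartan_diagonal e hstd Han hϖ hσ hvσ hHanh han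
  refine ⟨b, fun g => ?_⟩
  obtain ⟨k₁, k₂, hk₁, hk₁i, hk₂, hk₂i, d₀, hdiag, hd₀n, hd₀ker⟩ := hb g
  have hd0 : ∀ p, d₀ p ≠ 0 := fun p h0 => by
    have h := hd₀n (Fin.rev p)
    rw [Fin.rev_rev, h0, mul_zero] at h
    exact zero_ne_one h
  -- exponents `v(d₀ p) = exp (ex p)`, `a := -ex`, `a ∘ rev = -a`, `a = 0` on the kernel
  choose ex hex using fun p => exists_v_eq_exp (hd0 p)
  set a : Fin N → ℤ := fun p => -ex p with ha_def
  have harev : ∀ p, a (Fin.rev p) = -a p := fun p => by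
    have h := congrArg Valued.v (hd₀n p)
    rw [map_mul, hvσ, map_one, hex, hex, ← WithZero.exp_add, ← WithZero.exp_zero, WithZero.exp_inj] at h
    rw [ha_def]; dsimp only; omega
  have ha0 : ∀ u : Fin m, a (e (Sum.inr (Sum.inl u))) = 0 := fun u => by
    have h := hex (e (Sum.inr (Sum.inl u)))
    rw [hd₀ker, map_one, ← WithZero.exp_zero, WithZero.exp_inj] at h
    rw [ha_def]; dsimp only; omega
  obtain ⟨τ, hτ, hτk, hanti, _⟩ := exists_perm_kernel_antitone e hstd harev ha0
  -- the Weyl element `P = P_τ ∈ U`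
  set P : unitaryGroupOfForm σ (wittFormOn e Han) := ⟨permGL τ, permGL_mem_unitaryGroupOfForm_witt σ e hstd Han τ hτ hτk⟩ with hP_def
  have hPval : ((P : unitaryGroupOfForm σ (wittFormOn e Han)) : GL (Fin N) K) = permGL τ := rfl
  have hPb : ∀ i j, Valued.v (((P : GL (Fin N) K) : Matrix (Fin N) (Fin N) K) i j) ≤ 1 := fun i j => by
    rw [hPval]; exact v_permGL_apply_le_one τ i j
  have hPib : ∀ i j, Valued.v ((((P⁻¹ : unitaryGroupOfForm σ (wittFormOn e Han)) : GL (Fin N) K) : Matrix (Fin N) (Fin N) K) i j) ≤ 1 := fun i j => by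
    rw [Subgroup.coe_inv, hPval, permGL_inv]; exact v_permGL_apply_le_one τ⁻¹ i j
  -- `P (k₁ g k₂) P⁻¹ = diag(d₀ ∘ τ)`
  set dU : Fin N → Kˣ := fun p => Units.mk0 (d₀ p) (hd0 p) with hdU_def
  have hXval : ((k₁ * g * k₂ : unitaryGroupOfForm σ (wittFormOn e Han)) : GL (Fin N) K) = diagonalGL (Fin N) K dU := by
    refine Units.ext ?_
    rw [hdiag, coe_diagonalGL]
    rfl
  have hconj : (((P * (k₁ * g * k₂) * P⁻¹ : unitaryGroupOfForm σ (wittFormOn e Han)) : GL (Fin N) K) : Matrix (Fin N) (Fin N) K) =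
      Matrix.diagonal (d₀ ∘ τ) := by
    rw [Subgroup.coe_mul, Subgroup.coe_mul, Subgroup.coe_inv, hXval, hPval, permGL_mul_diagonalGL_mul_permGL_inv, coe_diagonalGL]
    rfl
  refine ⟨P * k₁, k₂ * P⁻¹, fun i j => ?_, fun i j => ?_, fun i j => ?_, fun i j => ?_, d₀ ∘ τ, fun k => a (τ k), ?_, fun i => ?_, fun u => ?_,
    fun k => ?_, fun i j hij => hanti hij⟩
  · rw [Subgroup.coe_mul, Units.val_mul]
    exact (v_mul_apply_le hPb hk₁ i j).trans (le_of_eq (one_mul _))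
  · rw [_root_.mul_inv_rev, Subgroup.coe_mul, Units.val_mul]
    exact (v_mul_apply_le hk₁i hPib i j).trans (le_of_eq (mul_one _))
  · rw [Subgroup.coe_mul, Units.val_mul]
    exact (v_mul_apply_le hk₂ hPib i j).trans (le_of_eq (mul_one _))
  · rw [_root_.mul_inv_rev, inv_inv, Subgroup.coe_mul, Units.val_mul]
    exact (v_mul_apply_le hPb hk₂i i j).trans (le_of_eq (one_mul _))
  · rw [show P * k₁ * g * (k₂ * P⁻¹) = P * (k₁ * g * k₂) * P⁻¹ by group]
    exact hconj
  · rw [Function.comp_apply, Function.comp_apply, hτ]; exact hd₀n (τ i)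
  · rw [Function.comp_apply, hτk]; exact hd₀ker u
  · rw [Function.comp_apply, hex, ha_def]; dsimp only; rw [neg_neg]

end Sorted

end Summit.HodgeConjecture.HodgeConjecture.Cruxes.H413.K2E3WittBoundedCartanNormalForm

end
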